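import Literature.AlgebraicGeometry.HodgeTheory.CodimTwoDivisorPullbackGenerated
import Literature.AlgebraicGeometry.HodgeTheory.HodgeClassesIsogenyInvariance
import HarnessLib

/-!
# Moonen–Zarhin 1999, Thm. 0.2 (1)–(2) IN ALL CODIMENSIONS from its codimension-`2` part: on an abelian FIVEFOLD,
# `B³ ⊆ D³ + [H] · Σ_α α^* B²(X')` (hard Lefschetz), `Bᵖ = Dᵖ` for `p ∉ {2, 3}`, and the `W_{k,α}` form
# `Bᵖ ⊆ Dᵖ + D^{p-2} · Σ_{k,α} W_{k,α}` granted `B² ⊆ D² + Σ W_k` on the fourfold quotients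

Family `hodge`, layer `Literature/AlgebraicGeometry/HodgeTheory`; namespace `Literature.AlgebraicGeometry.HodgeTheory`.
THEOREMS ONLY (no definition, no named fact, sorry-free; D-0026). Written for the cell `pub-hodge-ring2`
(literature seat, gen 70, programme R47-A = heir (H6) «codim 3 / `W_{k,α}`» of gens 66–69). HONEST FRAMING (cell rule,
verbatim): research route conditional on HC_CM; not a corollary; Q11.4-sentence-2 already refuted in dim ≥ 3 —
nothing here uses HC_CM or Markman's theorem; the codimension-`2` statements enter as HYPOTHESES
(`IsCodimTwoDivisorPullbackGenerated A`, the pointwise body of the tree's named fact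
`MoonenZarhin1999_codimTwoHodgeClasses_abelianFivefold`, which the cell DISCHARGES Summit-side in
`Summits/HodgeConjecture/Ring2/FivefoldFactHolds`; and `IsCodimTwoDivisorWeilGenerated B` on the fourfold targets, the
pointwise body of `MoonenZarhin1999_codimTwoHodgeClasses_abelianFourfold`).

## The print

B. Moonen, Yu. Zarhin, *Hodge classes on abelian varieties of low dimension*, Math. Ann. **315** (1999) 711–733
[held: `paper:arxiv-math_9901113`]. Thm. 0.2 (p. 712; p0001 L144–L165): «(1) Suppose we are in case (e). Consider the
space of Weil classes `W_k ⊂ B²(X₁ × X₂)` and write `W_{k,α} ⊂ B²(X)` for its image under the map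
`B²(X₁ × X₂) → B²(X)` induced by a surjective homomorphism `α : X → X₁ × X₂`. Then the Hodge ring `B•(X)` is generated
by the subalgebra `D•(X)` of divisor classes together with the subspaces `W_{k,α}`. […] (2) Suppose we are in case (f).
[…] In particular, `B•(X)` is generated by the divisor classes `D•(X)` together with the pull-backs of the Weil classes
in `W_k ⊂ B²(X₁ × X₂)`»; the remark after Thm. 0.2 (p0002 L13–L16): «in the cases (e) and (f) the pull-backs of the Weil
classes are needed to generate the Hodge ring of `X`; in these cases we have `D²(X) ≠ B²(X)` and `D³(X) ≠ B³(X)`»;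
§5 (5.12) (p0011 L7–L21): «All that remains to be done is the computation of the Hodge rings in the cases (e), (f) and
(g). […] By the duality `Hʲ(X,ℚ)(5) ≅ H^{10-j}(X,ℚ)^∨` we only have to show that `B²(X) ⊂ H⁴(X,ℚ)` is generated by
`D²(X)` and the spaces `W_{k,α}`». The tree types the codimension-`2` conclusion for ALL fivefolds in the weak pull-back
form «`B²(X) = D²(X) + Σ_α α^* B²(X')`» (Thm. 0.2 with (2.8); predicate `IsCodimTwoDivisorPullbackGenerated`, file
`CodimTwoDivisorPullbackGenerated`), and Thm. 0.1 in codimension `2` as «`B²(X') = D²(X') + Σ_k W_k`» (predicate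
`IsCodimTwoDivisorWeilGenerated`, file `CodimTwoDivisorWeilGenerated`).

## What is proved (real carriers `Hᵏ(X(ℂ); ℂ)`, `IsRationalClass`, `IsOfHodgeType`, `divisorClassesSpan = D ⊗ ℂ`)

THE ONE DEVIATION FROM PRINT: the passage from codimension `2` to codimension `3` is done by HARD LEFSCHETZ (Voisin I,
Thm. 6.25, Rem. 6.27 — the tree's THEOREM `nonempty_hardLefschetzNFold_holds`: `L = [H] ∪ · : H⁴(X) ≅ H⁶(X)` for a
fivefold, a bijection on rational classes and on Hodge types shifted by `(1,1)`, `HardLefschetzNFold.exists_hdg_preimage`)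
instead of the printed duality `Hʲ(X,ℚ)(5) ≅ H^{10-j}(X,ℚ)^∨`; it yields the sharper `B³ = L(B²) ⊆ D³ + [H] · Σ_α α^* B²(X')`
(only the hyperplane class is needed in front of the pull-backs), exactly as the tree's `DivisorClassesHardLefschetz`
does for the divisor ring (`B^{n-l} ⊆ D^{n-l}` from `Bˡ ⊆ Dˡ`).

* §1 `HardLefschetzNFold.L_one_apply` (`L¹ c = [H] ∪ c`) and **`HardLefschetzNFold.mem_sup_span_image_of_index`** — the
  hard-Lefschetz push for an ENLARGED target: on a smooth projective `n`-fold, if every rational `(l,l)`-class lies in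
  `Dˡ ⊗ ℂ ⊔ span S`, then for `2l + j = n` every rational `(l+j, l+j)`-class lies in `D^{l+j} ⊗ ℂ ⊔ span Lʲ(S)`
  (generalises `HardLefschetzNFold.mem_divisorClassesSpan_of_index`, the case `S = ∅`).
* §2 FIVEFOLDS, from `IsCodimTwoDivisorPullbackGenerated A` (hypothesis; a theorem of the cell for every fivefold):
  **`IsCodimTwoDivisorPullbackGenerated.codimThree`** — `B³(A) ⊆ D³(A) ⊗ ℂ ⊔ span {κ ∪ α^* w}` over rational
  `(1,1)`-classes `κ` (in fact `κ = [H]` suffices: `…codimThree_hyperplane`), surjective homomorphisms `α : A ⟶ B` onto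
  abelian FOURFOLDS and rational `(2,2)`-classes `w` on `B` — the codimension-`3` part of Thm. 0.2 (1)–(2);
  `hodgeClasses_divisorial_of_dim_eq_five_of_ne` — `Bᵖ(A) ⊆ Dᵖ(A) ⊗ ℂ` for `p ∉ {2, 3}` (degrees `0, 1` by definition,
  `4, 5` by hard Lefschetz from degrees `1, 0`; `p > 5` vacuous); so on a fivefold Thm. 0.2's «the Hodge ring is
  generated by divisor classes and the pull-backs» holds in EVERY degree as soon as it holds in degree `4`.
* §3 THE `W_{k,α}` FORM: if moreover every fourfold target `B` of a surjective `α : A ⟶ B` satisfies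
  `IsCodimTwoDivisorWeilGenerated B` (`B²(B) ⊆ D²(B) + Σ_k W_k`; hypothesis — unconditional in the tree for non-simple,
  CM and type IV(1,1) fourfolds, and the content of the fourfold fact in general), then pulling back `D²(B) ⊗ ℂ` lands in
  `D²(A) ⊗ ℂ` (`AbelianVariety.map_mem_divisorClassesSpan`) and
  **`IsCodimTwoDivisorPullbackGenerated.codimTwo_weil`**: `B²(A) ⊆ D²(A) ⊗ ℂ ⊔ span {α^* w : w a rational (2,2) Weil
  class of (B, φ, d)}` = «`D²(X) + Σ W_{k,α}`», **`…codimThree_weil`**: `B³(A) ⊆ D³(A) ⊗ ℂ ⊔ span {κ ∪ α^* w}` =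
  «`D³(X) + D¹(X) · Σ W_{k,α}`»; fed with the fourfold FACT as a hypothesis: `…codimTwo_weil_of_fourfoldFact`,
  `…codimThree_weil_of_fourfoldFact`.
* §4 FOURFOLDS: `hodgeClasses_divisorial_of_dim_eq_four_of_ne_two` — `Bᵖ(B) ⊆ Dᵖ(B) ⊗ ℂ` for `p ≠ 2` on every
  abelian fourfold, so Thm. 0.1 («`B•(X)` is generated by `D•(X)` and the `W_k ⊂ B²(X)`») in all codimensions IS its
  codimension-`2` part `IsCodimTwoDivisorWeilGenerated` (`isCodimTwoDivisorWeilGenerated_iff_all_codim`).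

Relies on nothing unproved (`nonempty_hardLefschetzNFold_holds`, `cupProduct_gradedComm_holds` are theorems of the
tree). NOT here: `D³ ≠ B³` in cases (e), (f) (the non-degeneracy remark); the identification of the pulled-back planes
with Moonen–Zarhin's TWO spaces `W_{k,α₁}`, `W_{k,α₂}` in case (e) (we allow all `α`); any Hodge-conjecture statement
(for HC the tree routes the degrees above the middle through `mem_algebraicClasses_of_lt_of_nonempty` already).

## References

* [MoonenZarhin1999LowDim] B. Moonen, Yu. Zarhin, Math. Ann. 315 (1999) 711–733, Thm. 0.1, Thm. 0.2 (1)–(2), the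
  remark after Thm. 0.2 (p. 712), §5 (5.12). [cite: MoonenZarhin1999LowDim, Thm. 0.2 (1)–(2) and §5 (5.12)]
* [VoisinHodgeI2002] C. Voisin, *Hodge Theory and Complex Algebraic Geometry I*, CUP 2002, Thm. 6.25, Rem. 6.27,
  §7.1.2, §11.3. [cite: VoisinHodgeI2002, Thm. 6.25 and Rem. 6.27]
* [vanGeemen1994HodgeAV] B. van Geemen, LNM 1594 (1994), §2.4–2.5 (p. 235) (`Dᵖ ⊂ Bᵖ`, the ring `D`), 3.6–3.7.
  [cite: vanGeemen1994HodgeAV, §2.4–2.5]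
* [HatcherAT2002] A. Hatcher, *Algebraic Topology*, CUP 2002, §3.2 Prop. 3.10 (naturality of `∪`), Thm. 3.11.
  [cite: HatcherAT2002, §3.2 Prop. 3.10]
-/

noncomputable section

open CategoryTheory AlgebraicGeometry Module

namespace Literature.AlgebraicGeometry.HodgeTheory

open Literature.AlgebraicTopology.SingularHomology
open Literature.AlgebraicGeometry.Motives (AbelianVariety IsSmoothProjective)
open Literature.Barriers.HodgeConjecture (divisorClassesSpan)
open Literature.Geometry.Kaehler

/-! ### §1 Hard Lefschetz pushes «`Bˡ ⊆ Dˡ ⊗ ℂ ⊔ span S`» to the complementary degree -/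

section SmoothProjective

variable {n : ℕ} {X : Motives.SchemeOver ℂ}

namespace HardLefschetzNFold

/-- `L¹ c = [H] ∪ c` (the first iterate of the Lefschetz operator of the structure is cup product with the hyperplane
class). [cite: VoisinHodgeI2002, §6.2.3 (6.7) and Rem. 6.27] -/
theorem L_one_apply (Λ : HardLefschetzNFold n X) (k m : ℕ) (hm : k + 2 * 1 = m) (h2 : 2 + k = m)
    (c : complexBetti X k) : Λ.L 1 k m hm c = cupProduct h2 Λ.hyperplaneClass c := by
  change lefschetzPowTo Λ.hyperplaneClass (0 + 1) k m hm c = _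
  rw [lefschetzPowTo_succ_apply Λ.hyperplaneClass 0 k k m rfl hm h2, lefschetzPowTo_zero_apply,
    lefschetzOperator_apply]

/-- **Hard Lefschetz for an enlarged target** (index form, no subtraction): on a smooth projective complex `n`-fold,
let `S ⊆ H²ˡ(X(ℂ); ℂ)` and suppose every rational `(l,l)`-class lies in `Dˡ ⊗ ℂ ⊔ span_ℂ S`. Then for `2l + j = n`
every rational `(l+j, l+j)`-class `c` lies in `D^{l+j} ⊗ ℂ ⊔ span_ℂ Lʲ(S)`: `c = Lʲ c'` with `c'` rational of type
`(l,l)` (`exists_hdg_preimage`), `c' = d + s`, `Lʲ d ∈ D^{l+j} ⊗ ℂ` (`L_mem_divisorClassesSpan_of_mem`: `[H]` is a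
rational `(1,1)`-class and `D` is a ring) and `Lʲ s ∈ Lʲ(span S) = span Lʲ(S)`. The case `S = ∅` is the tree's
`mem_divisorClassesSpan_of_index` («`B = D` propagates up»); Moonen–Zarhin use the duality `Hʲ(X,ℚ)(5) ≅ H^{10-j}(X,ℚ)^∨`
at this point (§5 (5.12)). [cite: MoonenZarhin1999LowDim, §5 (5.12)] [cite: VoisinHodgeI2002, Thm. 6.25 and Rem. 6.27] -/
theorem mem_sup_span_image_of_index (Λ : HardLefschetzNFold n X) (hX : Motives.IsSmoothProjective n X)
    {l j p : ℕ} (hjk : 2 * l + j = n) (hp : l + j = p) (hm : 2 * l + 2 * j = 2 * p)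
    (S : Set (complexBetti X (2 * l)))
    (hyp : ∀ c' : complexBetti X (2 * l), IsRationalClass c' → IsOfHodgeType n X (2 * l) l l c' →
      c' ∈ divisorClassesSpan X n l ⊔ Submodule.span ℂ S)
    (c : complexBetti X (2 * p)) (hc : IsRationalClass c) (hpp : IsOfHodgeType n X (2 * p) p p c) :
    c ∈ divisorClassesSpan X n p ⊔ Submodule.span ℂ ((Λ.L j (2 * l) (2 * p) hm) '' S) := by
  subst hp
  obtain ⟨c', hc', hll, rfl⟩ := Λ.exists_hdg_preimage hjk (2 * (l + j)) hm l l c hc hpp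
  obtain ⟨d, hd, s, hs, hds⟩ := Submodule.mem_sup.1 (hyp c' hc' hll)
  rw [← hds, map_add]
  refine Submodule.add_mem_sup (Λ.L_mem_divisorClassesSpan_of_mem hX j l hm hd) ?_
  rw [← Submodule.map_span]
  exact Submodule.mem_map_of_mem hs

end HardLefschetzNFold

end SmoothProjective

/-! ### §2 Abelian fivefolds: codimension `3` from codimension `2`, and the automatic degrees -/

section AbelianVariety

variable {A : AbelianVariety ℂ}

/-- **Moonen–Zarhin 1999, Thm. 0.2 (1)–(2), CODIMENSION-`3` PART, hyperplane form.** Let `A` be a complex abelian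
FIVEFOLD with `B²(A) ⊆ D²(A) ⊗ ℂ + Σ_α α^* B²(A')` (`IsCodimTwoDivisorPullbackGenerated A`: rational `(2,2)`-classes are
combinations of divisor products and of pull-backs `α^* w` of rational `(2,2)`-classes `w` on abelian fourfolds `A'`
along surjective homomorphisms `α`). Then every rational `(3,3)`-class `c ∈ H⁶(A(ℂ); ℂ)` lies in
`D³(A) ⊗ ℂ ⊔ span_ℂ {[H] ∪ α^* w}`, `[H]` the hyperplane class of a hard-Lefschetz structure `Λ` on `A`
(`c = L c'`, `c'` rational of type `(2,2)`). [cite: MoonenZarhin1999LowDim, Thm. 0.2 (1)–(2) and §5 (5.12)]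
[cite: VoisinHodgeI2002, Thm. 6.25 and Rem. 6.27] -/
theorem IsCodimTwoDivisorPullbackGenerated.codimThree_hyperplane (h : IsCodimTwoDivisorPullbackGenerated A)
    (hA : A.dim = 5) (Λ : HardLefschetzNFold A.dim A.X) (c : complexBetti A.X (2 * 3)) (hc : IsRationalClass c)
    (h33 : IsOfHodgeType A.dim A.X (2 * 3) 3 3 c) :
    c ∈ divisorClassesSpan A.X A.dim 3 ⊔
      Submodule.span ℂ {x : complexBetti A.X (2 * 3) |
        ∃ (B : AbelianVariety ℂ) (α : A ⟶ B) (w : complexBetti B.X (2 * 2)),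
          B.dim = 4 ∧ Surjective (AbelianVariety.Hom.toSchemeHom α) ∧
          IsRationalClass w ∧ IsOfHodgeType B.dim B.X (2 * 2) 2 2 w ∧
          x = cupProduct (show 2 + 2 * 2 = 2 * 3 by norm_num) Λ.hyperplaneClass
            (complexBetti.map α.hom.hom.hom (2 * 2) w)} := by
  have hX : IsSmoothProjective A.dim A.X := AbelianVariety.isSmoothProjective_holds
  have hmem := Λ.mem_sup_span_image_of_index hX (l := 2) (j := 1) (p := 3) (by omega) (by norm_num)
    (by norm_num) _ h c hc h33
  obtain ⟨e, he, s, hs, rfl⟩ := Submodule.mem_sup.1 hmem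
  refine Submodule.add_mem_sup he (Submodule.span_mono ?_ hs)
  rintro _ ⟨w', ⟨B, α, w, hB, hα, hwQ, hwH, rfl⟩, rfl⟩
  exact ⟨B, α, w, hB, hα, hwQ, hwH, Λ.L_one_apply (2 * 2) (2 * 3) (by norm_num) (by norm_num) _⟩

/-- **Moonen–Zarhin 1999, Thm. 0.2 (1)–(2), CODIMENSION-`3` PART: `B³(X) ⊆ D³(X) + D¹(X) · Σ_α α^* B²(X')`.** For a
complex abelian FIVEFOLD `A` with `B²(A) ⊆ D²(A) ⊗ ℂ + Σ_α α^* B²(A')` (`IsCodimTwoDivisorPullbackGenerated A`), every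
rational `(3,3)`-class lies in `D³(A) ⊗ ℂ ⊔ span_ℂ {κ ∪ α^* w}` over the rational `(1,1)`-classes `κ`, the surjective
homomorphisms `α : A ⟶ B` onto abelian FOURFOLDS and the rational `(2,2)`-classes `w` on `B` («the Hodge ring `B•(X)`
is generated by the subalgebra `D•(X)` of divisor classes together with the [pull-backs]», degree `6`; print reduces
to degree `4` by duality, the tree by hard Lefschetz, `κ = [H]`). [cite: MoonenZarhin1999LowDim, Thm. 0.2 (1)–(2) and §5 (5.12)]
[cite: VoisinHodgeI2002, Thm. 6.25 and Rem. 6.27] -/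
theorem IsCodimTwoDivisorPullbackGenerated.codimThree (h : IsCodimTwoDivisorPullbackGenerated A) (hA : A.dim = 5)
    (c : complexBetti A.X (2 * 3)) (hc : IsRationalClass c) (h33 : IsOfHodgeType A.dim A.X (2 * 3) 3 3 c) :
    c ∈ divisorClassesSpan A.X A.dim 3 ⊔
      Submodule.span ℂ {x : complexBetti A.X (2 * 3) |
        ∃ (κ : complexBetti A.X 2) (B : AbelianVariety ℂ) (α : A ⟶ B) (w : complexBetti B.X (2 * 2)),
          IsRationalClass κ ∧ IsOfHodgeType A.dim A.X 2 1 1 κ ∧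
          B.dim = 4 ∧ Surjective (AbelianVariety.Hom.toSchemeHom α) ∧
          IsRationalClass w ∧ IsOfHodgeType B.dim B.X (2 * 2) 2 2 w ∧
          x = cupProduct (show 2 + 2 * 2 = 2 * 3 by norm_num) κ (complexBetti.map α.hom.hom.hom (2 * 2) w)} := by
  have hX : IsSmoothProjective A.dim A.X := AbelianVariety.isSmoothProjective_holds
  obtain ⟨Λ⟩ := nonempty_hardLefschetzNFold_holds A.dim A.X hX
  obtain ⟨e, he, s, hs, rfl⟩ := Submodule.mem_sup.1 (h.codimThree_hyperplane hA Λ c hc h33)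
  refine Submodule.add_mem_sup he (Submodule.span_mono ?_ hs)
  rintro _ ⟨B, α, w, hB, hα, hwQ, hwH, rfl⟩
  exact ⟨Λ.hyperplaneClass, B, α, w, Λ.isRationalClass_hyperplaneClass, Λ.isOfHodgeType_hyperplaneClass hX,
    hB, hα, hwQ, hwH, rfl⟩

/-- **The automatic degrees on a fivefold**: for `p ∉ {2, 3}` every rational `(p,p)`-class on a complex abelian
fivefold lies in `Dᵖ ⊗ ℂ` (`p = 0, 1` by `H⁰ = ℂ·1` and the definition of `D`; `p = 4, 5` by hard Lefschetz from
degrees `1, 0`; `p > 5`: `H²ᵖ` has no `(p,p)`-classes). Hence Thm. 0.2's ring statement is decided in degrees `4` and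
`6`. [cite: MoonenZarhin1999LowDim, Introduction (p. 711) and Thm. 0.2] [cite: VoisinHodgeI2002, Thm. 6.25 and Rem. 6.27] -/
theorem hodgeClasses_divisorial_of_dim_eq_five_of_ne (hA : A.dim = 5) {p : ℕ} (hp2 : p ≠ 2) (hp3 : p ≠ 3)
    (c : complexBetti A.X (2 * p)) (hc : IsRationalClass c) (hpp : IsOfHodgeType A.dim A.X (2 * p) p p c) :
    c ∈ divisorClassesSpan A.X A.dim p :=
  hodgeClasses_divisorial_of_le_one_or_le_succ AbelianVariety.isSmoothProjective_holds (by omega) c hc hpp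

/-! ### §3 The `W_{k,α}` form: pulling back `B²(B) ⊆ D²(B) + Σ_k W_k` from the fourfold quotients -/

/-- **Moonen–Zarhin 1999, Thm. 0.2 (1)–(2) in codimension `2`, `W_{k,α}` FORM: `B²(X) ⊆ D²(X) + Σ_{k,α} W_{k,α}`.**
Let `A` be a complex abelian variety with `B²(A) ⊆ D²(A) ⊗ ℂ + Σ_α α^* B²(B)` (`IsCodimTwoDivisorPullbackGenerated A`),
and suppose every abelian FOURFOLD `B` that is the target of a surjective homomorphism `α : A ⟶ B` satisfies
`B²(B) ⊆ D²(B) ⊗ ℂ + Σ_k W_k` (`IsCodimTwoDivisorWeilGenerated B`, Thm. 0.1 in codimension `2` at `B`). Then every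
rational `(2,2)`-class on `A` lies in `D²(A) ⊗ ℂ ⊔ span_ℂ {α^* w}` over the rational `(2,2)` WEIL classes
`w ∈ weilClassesOf B φ 2 d` (`φ ≫ φ = -d`, `0 < d`) of those fourfolds — the `W_{k,α}` = «image of `W_k` under the map
induced by a surjective homomorphism `α`»; `α^*(D²(B) ⊗ ℂ) ⊆ D²(A) ⊗ ℂ` by functoriality of divisor products
(`AbelianVariety.map_mem_divisorClassesSpan`). [cite: MoonenZarhin1999LowDim, Thm. 0.2 (1)–(2) and Thm. 0.1]
[cite: vanGeemen1994HodgeAV, §2.4–2.5] [cite: HatcherAT2002, §3.2 Prop. 3.10] -/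
theorem IsCodimTwoDivisorPullbackGenerated.codimTwo_weil (h : IsCodimTwoDivisorPullbackGenerated A)
    (hB : ∀ (B : AbelianVariety ℂ) (α : A ⟶ B), B.dim = 4 → Surjective (AbelianVariety.Hom.toSchemeHom α) →
      IsCodimTwoDivisorWeilGenerated B)
    (c : complexBetti A.X (2 * 2)) (hc : IsRationalClass c) (h22 : IsOfHodgeType A.dim A.X (2 * 2) 2 2 c) :
    c ∈ divisorClassesSpan A.X A.dim 2 ⊔
      Submodule.span ℂ {x : complexBetti A.X (2 * 2) |
        ∃ (B : AbelianVariety ℂ) (α : A ⟶ B) (d : ℕ) (φ : B ⟶ B) (w : complexBetti B.X (2 * 2)),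
          B.dim = 4 ∧ Surjective (AbelianVariety.Hom.toSchemeHom α) ∧ 0 < d ∧ φ ≫ φ = -(d • 𝟙 B) ∧
          IsRationalClass w ∧ IsOfHodgeType B.dim B.X (2 * 2) 2 2 w ∧ w ∈ weilClassesOf B φ 2 d ∧
          x = complexBetti.map α.hom.hom.hom (2 * 2) w} := by
  obtain ⟨e₀, he₀, s₀, hs₀, hes₀⟩ := Submodule.mem_sup.1 (h c hc h22)
  rw [← hes₀]
  refine Submodule.add_mem _ (Submodule.mem_sup_left he₀) ?_
  clear hes₀
  induction hs₀ using Submodule.span_induction with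
  | mem x hx =>
    obtain ⟨B, α, w, hB4, hα, hwQ, hwH, rfl⟩ := hx
    obtain ⟨e, he, s, hs, hes⟩ := Submodule.mem_sup.1 (hB B α hB4 hα w hwQ hwH)
    rw [← hes, map_add]
    refine Submodule.add_mem_sup (AbelianVariety.map_mem_divisorClassesSpan α he) ?_
    clear hes
    induction hs using Submodule.span_induction with
    | mem y hy =>
      obtain ⟨d, φ, hd, hφ, hyQ, hyH, hyW⟩ := hy
      exact Submodule.subset_span ⟨B, α, d, φ, y, hB4, hα, hd, hφ, hyQ, hyH, hyW, rfl⟩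
    | zero => rw [map_zero]; exact Submodule.zero_mem _
    | add a b _ _ ha hb => rw [map_add]; exact Submodule.add_mem _ ha hb
    | smul r a _ ha => rw [map_smul]; exact Submodule.smul_mem _ r ha
  | zero => exact Submodule.zero_mem _
  | add a b _ _ ha hb => exact Submodule.add_mem _ ha hb
  | smul r a _ ha => exact Submodule.smul_mem _ r ha

/-- **Moonen–Zarhin 1999, Thm. 0.2 (1)–(2) in codimension `3`, `W_{k,α}` FORM: `B³(X) ⊆ D³(X) + D¹(X) · Σ_{k,α} W_{k,α}`**
for a complex abelian FIVEFOLD `A` with `B²(A) ⊆ D²(A) ⊗ ℂ + Σ_α α^* B²(B)` whose surjective fourfold quotients satisfy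
`B²(B) ⊆ D²(B) ⊗ ℂ + Σ_k W_k`: every rational `(3,3)`-class lies in `D³(A) ⊗ ℂ ⊔ span_ℂ {κ ∪ α^* w}`, `κ` a rational
`(1,1)`-class (indeed `κ = [H]`), `w` a rational `(2,2)` Weil class of a fourfold quotient. Hard Lefschetz from the
previous theorem. [cite: MoonenZarhin1999LowDim, Thm. 0.2 (1)–(2) and §5 (5.12)] [cite: VoisinHodgeI2002, Thm. 6.25 and Rem. 6.27] -/
theorem IsCodimTwoDivisorPullbackGenerated.codimThree_weil (h : IsCodimTwoDivisorPullbackGenerated A) (hA : A.dim = 5)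
    (hB : ∀ (B : AbelianVariety ℂ) (α : A ⟶ B), B.dim = 4 → Surjective (AbelianVariety.Hom.toSchemeHom α) →
      IsCodimTwoDivisorWeilGenerated B)
    (c : complexBetti A.X (2 * 3)) (hc : IsRationalClass c) (h33 : IsOfHodgeType A.dim A.X (2 * 3) 3 3 c) :
    c ∈ divisorClassesSpan A.X A.dim 3 ⊔
      Submodule.span ℂ {x : complexBetti A.X (2 * 3) |
        ∃ (κ : complexBetti A.X 2) (B : AbelianVariety ℂ) (α : A ⟶ B) (d : ℕ) (φ : B ⟶ B)
          (w : complexBetti B.X (2 * 2)),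
          IsRationalClass κ ∧ IsOfHodgeType A.dim A.X 2 1 1 κ ∧
          B.dim = 4 ∧ Surjective (AbelianVariety.Hom.toSchemeHom α) ∧ 0 < d ∧ φ ≫ φ = -(d • 𝟙 B) ∧
          IsRationalClass w ∧ IsOfHodgeType B.dim B.X (2 * 2) 2 2 w ∧ w ∈ weilClassesOf B φ 2 d ∧
          x = cupProduct (show 2 + 2 * 2 = 2 * 3 by norm_num) κ (complexBetti.map α.hom.hom.hom (2 * 2) w)} := by
  have hX : IsSmoothProjective A.dim A.X := AbelianVariety.isSmoothProjective_holds
  obtain ⟨Λ⟩ := nonempty_hardLefschetzNFold_holds A.dim A.X hX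
  have hmem := Λ.mem_sup_span_image_of_index hX (l := 2) (j := 1) (p := 3) (by omega) (by norm_num)
    (by norm_num) _ (h.codimTwo_weil hB) c hc h33
  obtain ⟨e, he, s, hs, rfl⟩ := Submodule.mem_sup.1 hmem
  refine Submodule.add_mem_sup he (Submodule.span_mono ?_ hs)
  rintro _ ⟨w', ⟨B, α, d, φ, w, hB4, hα, hd, hφ, hwQ, hwH, hwW, rfl⟩, rfl⟩
  exact ⟨Λ.hyperplaneClass, B, α, d, φ, w, Λ.isRationalClass_hyperplaneClass, Λ.isOfHodgeType_hyperplaneClass hX,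
    hB4, hα, hd, hφ, hwQ, hwH, hwW, Λ.L_one_apply (2 * 2) (2 * 3) (by norm_num) (by norm_num) _⟩

/-- `W_{k,α}` form in codimension `2`, the fourfold inputs supplied by the tree's named FACT
`MoonenZarhin1999_codimTwoHodgeClasses_abelianFourfold` (Thm. 0.1 in codimension `2`) taken as a HYPOTHESIS.
[cite: MoonenZarhin1999LowDim, Thm. 0.1 and Thm. 0.2 (1)–(2)] -/
theorem IsCodimTwoDivisorPullbackGenerated.codimTwo_weil_of_fourfoldFact (h : IsCodimTwoDivisorPullbackGenerated A)
    (h01 : MoonenZarhin1999_codimTwoHodgeClasses_abelianFourfold)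
    (c : complexBetti A.X (2 * 2)) (hc : IsRationalClass c) (h22 : IsOfHodgeType A.dim A.X (2 * 2) 2 2 c) :
    c ∈ divisorClassesSpan A.X A.dim 2 ⊔
      Submodule.span ℂ {x : complexBetti A.X (2 * 2) |
        ∃ (B : AbelianVariety ℂ) (α : A ⟶ B) (d : ℕ) (φ : B ⟶ B) (w : complexBetti B.X (2 * 2)),
          B.dim = 4 ∧ Surjective (AbelianVariety.Hom.toSchemeHom α) ∧ 0 < d ∧ φ ≫ φ = -(d • 𝟙 B) ∧
          IsRationalClass w ∧ IsOfHodgeType B.dim B.X (2 * 2) 2 2 w ∧ w ∈ weilClassesOf B φ 2 d ∧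
          x = complexBetti.map α.hom.hom.hom (2 * 2) w} :=
  h.codimTwo_weil (fun B _ hB4 _ => h01 B hB4) c hc h22

/-- `W_{k,α}` form in codimension `3` on a fivefold, the fourfold inputs supplied by the named FACT
`MoonenZarhin1999_codimTwoHodgeClasses_abelianFourfold` taken as a HYPOTHESIS.
[cite: MoonenZarhin1999LowDim, Thm. 0.1, Thm. 0.2 (1)–(2) and §5 (5.12)] -/
theorem IsCodimTwoDivisorPullbackGenerated.codimThree_weil_of_fourfoldFact (h : IsCodimTwoDivisorPullbackGenerated A)
    (hA : A.dim = 5) (h01 : MoonenZarhin1999_codimTwoHodgeClasses_abelianFourfold)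
    (c : complexBetti A.X (2 * 3)) (hc : IsRationalClass c) (h33 : IsOfHodgeType A.dim A.X (2 * 3) 3 3 c) :
    c ∈ divisorClassesSpan A.X A.dim 3 ⊔
      Submodule.span ℂ {x : complexBetti A.X (2 * 3) |
        ∃ (κ : complexBetti A.X 2) (B : AbelianVariety ℂ) (α : A ⟶ B) (d : ℕ) (φ : B ⟶ B)
          (w : complexBetti B.X (2 * 2)),
          IsRationalClass κ ∧ IsOfHodgeType A.dim A.X 2 1 1 κ ∧
          B.dim = 4 ∧ Surjective (AbelianVariety.Hom.toSchemeHom α) ∧ 0 < d ∧ φ ≫ φ = -(d • 𝟙 B) ∧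
          IsRationalClass w ∧ IsOfHodgeType B.dim B.X (2 * 2) 2 2 w ∧ w ∈ weilClassesOf B φ 2 d ∧
          x = cupProduct (show 2 + 2 * 2 = 2 * 3 by norm_num) κ (complexBetti.map α.hom.hom.hom (2 * 2) w)} :=
  h.codimThree_weil hA (fun B _ hB4 _ => h01 B hB4) c hc h33

/-! ### §4 Abelian fourfolds: Thm. 0.1 in all codimensions is its codimension-`2` part -/

/-- **The automatic degrees on a fourfold**: for `p ≠ 2` every rational `(p,p)`-class on a complex abelian fourfold
lies in `Dᵖ ⊗ ℂ` (`p = 0, 1`; `p = 3, 4` by hard Lefschetz from degrees `1, 0`; `p > 4` vacuous). So Thm. 0.1's «`B•(X)`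
is generated by `D•(X)` together with the space[s] of Weil classes `W_k ⊂ B²(X)`» holds in every degree as soon as it
holds in degree `4`. [cite: MoonenZarhin1999LowDim, Introduction (p. 711) and Thm. 0.1]
[cite: VoisinHodgeI2002, Thm. 6.25 and Rem. 6.27] -/
theorem hodgeClasses_divisorial_of_dim_eq_four_of_ne_two {B : AbelianVariety ℂ} (hB : B.dim = 4) {p : ℕ}
    (hp : p ≠ 2) (c : complexBetti B.X (2 * p)) (hc : IsRationalClass c)
    (hpp : IsOfHodgeType B.dim B.X (2 * p) p p c) : c ∈ divisorClassesSpan B.X B.dim p :=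
  hodgeClasses_divisorial_of_le_one_or_le_succ AbelianVariety.isSmoothProjective_holds (by omega) c hc hpp

/-- **Thm. 0.1 in all codimensions ⟺ its codimension-`2` part** on a complex abelian fourfold `B`:
`IsCodimTwoDivisorWeilGenerated B` iff for EVERY `p` every rational `(p,p)`-class lies in `Dᵖ ⊗ ℂ` or — in degree
`4` — in `D² ⊗ ℂ ⊔ span_ℂ {rational (2,2) Weil classes}`. [cite: MoonenZarhin1999LowDim, Thm. 0.1 with (1.4) and (1.9)]
[cite: VoisinHodgeI2002, Thm. 6.25 and Rem. 6.27] -/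
theorem isCodimTwoDivisorWeilGenerated_iff_all_codim {B : AbelianVariety ℂ} (hB : B.dim = 4) :
    IsCodimTwoDivisorWeilGenerated B ↔
      (∀ (p : ℕ), p ≠ 2 → ∀ c : complexBetti B.X (2 * p), IsRationalClass c →
        IsOfHodgeType B.dim B.X (2 * p) p p c → c ∈ divisorClassesSpan B.X B.dim p) ∧
      (∀ c : complexBetti B.X (2 * 2), IsRationalClass c → IsOfHodgeType B.dim B.X (2 * 2) 2 2 c →
        c ∈ divisorClassesSpan B.X B.dim 2 ⊔
          Submodule.span ℂ {w : complexBetti B.X (2 * 2) | ∃ (d : ℕ) (φ : B ⟶ B), 0 < d ∧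
            φ ≫ φ = -(d • 𝟙 B) ∧ IsRationalClass w ∧ IsOfHodgeType B.dim B.X (2 * 2) 2 2 w ∧
            w ∈ weilClassesOf B φ 2 d}) :=
  ⟨fun h => ⟨fun _ hp c hc hpp => hodgeClasses_divisorial_of_dim_eq_four_of_ne_two hB hp c hc hpp, h⟩,
    fun h => h.2⟩

end AbelianVariety

end Literature.AlgebraicGeometry.HodgeTheory

end
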